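import Literature.NumberTheory.Automorphic.DeligneSerreThm46aLeavesProofs
import Literature.NumberTheory.Automorphic.ArtinLFunctionsRankOneMatching
import HarnessLib

/-!
# Deligne–Serre 1974, Thm. 4.6 (a): discharge of the named fact `thm46a_artinConductorNat_eq`
(pure proofs; companion to `Literature.NumberTheory.Automorphic.LanglandsTunnellProofs`,
`Literature.NumberTheory.Automorphic.DeligneSerreThm46Proofs` and
`Literature.NumberTheory.Automorphic.DeligneSerreThm46aLeavesProofs`)

The named fact
`Literature.NumberTheory.Automorphic.ModularForms.DeligneSerre1974.thm46a_artinConductorNat_eq`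
(`LanglandsTunnellProofs`; Deligne–Serre, *Formes modulaires de poids 1*, Ann. Sci. ÉNS (4) 7
(1974), Thm. 4.6 (a), p. 514, with Rem. 4.3: the Artin conductor of a finite-image
representation `ρ : Γ_ℚ → GL₂(ℂ)` attached away from `N` to a weight-one newform of level `N`
is `N`) was proved in the tree **from the four inputs of the printed proof** (op. cit.
pp. 515–516, steps (i)–(iv)): `thm46a_of` (`DeligneSerreThm46Proofs`: steps (iii)–(iv) —
elimination of the `L`-functions between the functional equation of `Λ_f` and Artin's
functional equation of `L(s, ρ)` — and Lemme 4.9, all proved) takes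

1. (i) the weight-one functional equation `Λ_f(1 - s) = a Λ_{f̃}(s)` of a newform on `Γ₁(N)` —
   the theorem `DeligneSerre1974.weightOne_functionalEquation_holds`
   (`EllipticCurves/Gamma1NewformLSeriesFrickeProofs`, with the Mellin step
   `weightOne_functionalEquation_of` of `EllipticCurves/Gamma1FrickeFunctionalEquationProofs`);
2. (ii) Artin's functional equation `Λ(1 - s, ρ) = W Λ(s, ρ^∨)` over `ℚ` — the named fact
   `artin_functional_equation (K := ℚ)` (`ArtinLFunctions`), **now the theorem
   `artin_functional_equation_holds`** (`ArtinLFunctionsRankOneMatching`: Brauer's factorisation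
   of the completed Artin `L`-function, `brauer_completedArtinLFunction_eq_prod_zpow_holds`, and
   the degree-one case `artin_functional_equation_rankOne_holds` over every number field —
   Artin reciprocity, Hecke's functional equation (8.6) and the matching of conductors and
   Γ-factors — assembled by `artin_functional_equation_of_brauer_of_rankOne`; Neukirch VII (12.6));
3. Rem. 4.5 (oddness) — `DeligneSerre1974.rem45_isOdd_holds` (`DeligneSerreThm46bLeavesProofs`,
   from the unconditional Lemme 3.2 `lemma32_complex_holds`);
4. 1.8, `|a_p| ≤ 1` for `p ∣ N` — `IsNewform1.cuspCoeff_of_dvd_level_holds`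
   (`EllipticCurves/Gamma1NewformLSeriesProofs`).

`DeligneSerreThm46aLeavesProofs` recorded the resulting one-leaf form
`thm46a_of_artin_functional_equation (hFEρ : artin_functional_equation (K := ℚ))` and announced
the discharge as that theorem applied to `artin_functional_equation_holds`.  This file performs
it, and the same for the continuous-topology corollary `artinConductorNat_eq_level` of
`LanglandsTunnell` (`artinConductorNat_eq_level_of_artin_functional_equation`, finite image by
`ArtinRep.finite_range_holds`):

* `ModularForms.DeligneSerre1974.thm46a_artinConductorNat_eq_holds : thm46a_artinConductorNat_eq`;
* `artinConductorNat_eq_level_holds : artinConductorNat_eq_level`.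

No definition, no new named fact, nothing restated; the two imports are kept out of
`DeligneSerreThm46aLeavesProofs` so that the analytic part of the cluster does not acquire the
import closure of the Artin–Hecke matching.

## References

* P. Deligne, J.-P. Serre, *Formes modulaires de poids 1*, Ann. Sci. ÉNS (4) 7 (1974),
  507–530, doi:10.24033/asens.1277 — Thm. 4.6 (a) (p. 514) and its proof (i)–(iv), Lemme 4.9
  (pp. 515–516), Rem. 4.3, Rem. 4.5 (p. 514), 1.8 (pp. 509–510) (`DeligneSerreASENS1974`).
* J. Neukirch, *Algebraic Number Theory*, Grundlehren 322, Springer 1999, Ch. VII Thm. (12.6)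
  (`NeukirchANT1999`) — for input (ii).
-/

noncomputable section

open scoped MatrixGroups ModularForm NumberField

open CongruenceSubgroup

namespace Literature.NumberTheory.Automorphic

/-! ### Thm. 4.6 (a) (finite-image form, with Rem. 4.3) -/

namespace ModularForms.DeligneSerre1974

variable {N : ℕ} [NeZero N]

/-- **Deligne–Serre 1974, Thm. 4.6 (a) with Rem. 4.3 (discharge of the named fact
`thm46a_artinConductorNat_eq`).**  Let `f = Σ a_n qⁿ ∈ S₁(Γ₁(N))` be a newform of weight one and
let `ρ : Gal(ℚ̄/ℚ) → GL₂(ℂ)` be a representation with finite image attached to `f` away from `N`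
(`charpoly ρ(F_p) = X² − a_p X + ε(p)` for `p ∤ N`).  Then the Artin conductor of `ρ` is `N`.
Proof as printed (op. cit. pp. 515–516): (i) the functional equation of `Λ_f`
(`weightOne_functionalEquation_holds`), (ii) Artin's functional equation of `L(s, ρ)`
(`artin_functional_equation_holds (K := ℚ)`), (iii)–(iv) elimination and Lemme 4.9
(`thm46a_of`, through `thm46a_of_artin_functional_equation`), with Rem. 4.5 and 1.8
(`rem45_isOdd_holds`, `IsNewform1.cuspCoeff_of_dvd_level_holds`).
[cite: DeligneSerreASENS1974, Thm. 4.6 (a) and Rem. 4.3; proof pp. 515–516, (i)–(iv), Lemme 4.9] -/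
theorem thm46a_artinConductorNat_eq_holds : thm46a_artinConductorNat_eq (N := N) :=
  thm46a_of_artin_functional_equation artin_functional_equation_holds

end ModularForms.DeligneSerre1974

/-! ### The named fact `artinConductorNat_eq_level` of `LanglandsTunnell` -/

section Lang

open ModularForms.DeligneSerre1974

variable {N : ℕ} [NeZero N] {f : CuspForm (Gamma1 N) 1}
  {ρ : GaloisRepresentations.FramedArtinRep ℚ 2}

/-- **Discharge of `artinConductorNat_eq_level`** (Deligne–Serre 1974, Thm. 4.6 (a) with
Rem. 4.3, for a continuous `ρ : Γ_ℚ → GL₂(ℂ)`, `ℂ` with its usual topology): if `ρ` is attached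
away from `N` to the weight-one newform `f ∈ S₁(Γ₁(N))`, then `𝔣(ρ) = N`.  This is
`artinConductorNat_eq_level_of_artin_functional_equation` (`DeligneSerreThm46aLeavesProofs`:
`artinConductorNat_eq_level_of` — finite image by `ArtinRep.finite_range_holds` — over
`thm46a_of_artin_functional_equation`) applied to `artin_functional_equation_holds (K := ℚ)`.
[cite: DeligneSerreASENS1974, Thm. 4.6 (a) and Rem. 4.3] -/
theorem artinConductorNat_eq_level_holds : artinConductorNat_eq_level (f := f) (ρ := ρ) :=
  artinConductorNat_eq_level_of_artin_functional_equation artin_functional_equation_holds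

end Lang

end Literature.NumberTheory.Automorphic

end
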